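import Summits.QuantumFields.BalabanUV.T4Continuum.Support.GradedWellMeanCorrection
import Summits.QuantumFields.BalabanUV.T4Continuum.Support.GradedWellUnitSlice
import Summits.QuantumFields.BalabanUV.T4Continuum.Support.GradedWellGram
import Summits.QuantumFields.BalabanUV.T4Continuum.Support.GradedWellUnitMass

/-!
# T⁴ programme, spine node NE2 (U1a), sub-row Δ1 — graded well, crew socket (GW-W1), file 4 of 4 (THE END):
# SLICE COERCIVITY OF THE GRADED WELL WITH A LEVEL-FREE CONSTANT, `SliceCoercive curlT gradT G′_GW Q′_GWn Q_GW a cGW`, `cGW(d,L,m,a,a′) > 0`;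
# hence `regionGW` is coercive and `‖regionGW⁻¹‖ ≤ max(2/cGW, 2γ_GW⁻¹)` uniformly in the level (R49 (a) «(GW-W1) + (GW-S0) ⟹ γ»)

NE2 formalisation swarm `b2b-balaban-t4-ne2-formalise-*`, leaf 09 (gen 11), for the row-NE2 owner's socket **(GW-W1)** of RULINGS R47 (e) /
R48 (c) / R49 (a) (journal 2026-08-21).  THE ARGUMENT (Plancherel-free transfer from the unit torus; every brick landed, used BY NAME):
(T) unit gauge Poincaré (`GradedWellUnitSlice.exists_unit_gauge`, B5 (1.90) on the slice); (V) «GW-V» (leaf-07-g11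
`GradedWellUnitMass.unitMass_le_nsq_QvGW`, read on B5's rows by `GradedWellUnitDict.nsq_QvOp_eq_sum_avgS`; carried as `hV` in §3–§4,
discharged in §5); (E) the graded mean correction (`GradedWellMeanCorrection.exists_meanCorrection`) and §1 `‖Q_GW X‖² ≤ (m+1)L^{2m}‖X‖²`
⟹ §3 the GRADED gauge Poincaré `∃ μ ∈ N(Q′_GWn), ‖A − ∂μ‖² ≤ C₁‖curl A‖² + C₂‖Q_GW A‖²`; (O) Pythagoras on the residual orbit (§0, abstract)
⟹ `OrthSliceCoercive`; (S) gen 8's abstract `RegionGaugeSliceOrth.sliceCoercive_of_orthSlice` with `θ = 1` (owner's `QsGWn_mul_conjTranspose`),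
`hP` = the graded block Poincaré on `N(Q′_GW)` (owner's `GradedWellScalarCoercive.nsq_le_graded`, `C_P = 8d(m+1)`), `hκ` = leaf-05-g10's
level-free variational bound `GradedWellGram.form_SGW_ge` (`κ = σ_GW`), `hL` = `∂ᴴ∂ ≤ Δ′_GW` ⟹ `SliceCoercive … (c₀/(1 + C_P/κ))`.

 * §0 `orthSlice_of_gaugePoincare`.  §1 `sum_norm_sq_avgS_le`, **`nsq_QvGW_mulVec_le`**.  §2 `hP_GW`, `hκ_GW`, `hL_GW`.
 * §3 `gaugePoincare_GW_of_unitMass`.  §4 `orthSlice_GW_of_unitMass`, `sliceCoercive_GW_of_unitMass`, `cGW_pos`.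
 * §5 THE ENDs **`gaugePoincare_GW`**, **`sliceCoercive_GW (hL : 2 ≤ L) (hlay : ∀ y, layer y ≤ m) (ha : 0 < a) (ha′ : 0 < a′)`** = (GW-W1), and via the
   owner's `GradedWellSlice.coercive_regionGW_of_slice` + (GW-S0): **`coercive_regionGW`**, **`opNorm_inv_regionGW_le`**.

HONEST FRAMING (T4-DAG p. 1).  [folklore] finite-dimensional algebra / lattice calculus at MODEL level (`U = 1`, one layer map on unit blocks,
`m` fixed, finite torus, operator norm); constants ours and explicit; nothing printed is a hypothesis or a conclusion; NOT [B9] (3.16)/(3.23)–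
(3.27)/(3.48) as printed; (GW-W1) is ONE crew socket of the graded-well `hinjK` — the two-level leaf (GW-E) and the tower assembly are NOT here;
NE2 (U1a) NOT proved; spine PROVED 0/9 unchanged; NOT infinite volume / mass gap / Clay.  HONEST DEPENDENCY: continuum YM on T⁴ ⇐ BetaPertH ∧
nine spine estimates (0/9 proved); BetaPertH ⇐ (D1) ∧ (D4) ∧ CAP+tail; G-an2-4 gates asym, D1 and NE2/3/4.  ABSOLUTE RULE kept: no
`def … : Prop` fact, no cited hypothesis, zero `sorry`.
-/

noncomputable section

open scoped BigOperators ComplexConjugate Matrix Matrix.Norms.L2Operator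
open Finset

namespace Summit.QuantumFields.BalabanUV.T4Continuum.GradedWellSliceCoercive

open Literature.MathematicalPhysics.QuantumFieldTheory.Balaban1983to89.B5Prop11Plancherel (Tor fine)
open Literature.MathematicalPhysics.QuantumFieldTheory.Balaban1983to89.B5Prop11Lower (nsq nsq_nonneg)
open Literature.MathematicalPhysics.QuantumFieldTheory.Balaban1983to89.B5Block118 (tstep QsOp QvOp)
open Literature.MathematicalPhysics.QuantumFieldTheory.Balaban1983to89.B5Blocks16 (blockOf)
open Literature.MathematicalPhysics.QuantumFieldTheory.Balaban1983to89.B5Action121 (GradOp sdiff star_mulVec_dotProduct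
  dotProduct_mulVec_eq_star_conjTranspose_mulVec)
open Literature.MathematicalPhysics.QuantumFieldTheory.Balaban1983to89.B5G183RateUnitTower (lev lev_neZero)
open Summit.QuantumFields.BalabanUV.T4Continuum
open Summit.QuantumFields.BalabanUV.T4Continuum.SubtypeCompression (Coercive)
open Summit.QuantumFields.BalabanUV.T4Continuum.ScalarBlockPoincare (nsq_add_le)
open Summit.QuantumFields.BalabanUV.T4Continuum.ScalarAveragedPropagator (nsq_GradOp_mulVec dirichlet)
open Summit.QuantumFields.BalabanUV.T4Continuum.RegionGaugeProjection (gramK gaugeR nsq_QH_mulVec)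
open Summit.QuantumFields.BalabanUV.T4Continuum.RegionGaugeSlice (SliceCoercive)
open Summit.QuantumFields.BalabanUV.T4Continuum.RegionGaugeSliceOrth (OrthSliceCoercive nsq_add_of_orth sliceCoercive_of_orthSlice)
open Summit.QuantumFields.BalabanUV.T4Continuum.DirichletRegionTower (gamD gamD_pos)
open Summit.QuantumFields.BalabanUV.T4Continuum.GradedSubBlocks (Anchor Anc InSub site meanS avgS s_pos avgS_mulVec)
open Summit.QuantumFields.BalabanUV.T4Continuum.GradedSubBlocksPoincare (sum_sites_eq card_offsets)
open Summit.QuantumFields.BalabanUV.T4Continuum.GradedContourRefine (norm_sq_sum_le)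
open Summit.QuantumFields.BalabanUV.T4Continuum.GradedWellData
open Summit.QuantumFields.BalabanUV.T4Continuum.GradedWellSlice (QsGWn QsGWn_mul_conjTranspose QsGW_mulVec_eq_zero_of_normalised sliceData_GW
  coercive_regionGW_of_slice opNorm_inv_regionGW_le_of_slice)
open Summit.QuantumFields.BalabanUV.T4Continuum.GradedWellScalarCoercive (nsq_le_graded form_DpGW gamGW gamGW_pos coercive_DpGW isUnit_det_DpGW
  opNorm_GOmGW_le opNorm_DpGW_pos)
open Summit.QuantumFields.BalabanUV.T4Continuum.GradedWellGram (sigGW sigGW_pos form_SGW_ge)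
open Summit.QuantumFields.BalabanUV.T4Continuum.GradedWellPlanting (QsGWw_mulVec_apply)
open Summit.QuantumFields.BalabanUV.T4Continuum.GradedWellUnitSlice (exists_unit_gauge)
open Summit.QuantumFields.BalabanUV.T4Continuum.GradedWellUnitDict (meanS_eq_zero_of_QsOp nsq_QvOp_eq_sum_avgS)
open Summit.QuantumFields.BalabanUV.T4Continuum.GradedWellMeanCorrection (rowMin nsq_QvGW_eq_sum CE exists_meanCorrection)
open Summit.QuantumFields.BalabanUV.T4Continuum.GradedWellUnitMass (unitMass_le_nsq_QvGW)

variable {d : ℕ}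

/-! ## §0 Pythagoras on the residual orbit (abstract) -/

section Abstract

variable {m v w u uv : Type*} [Fintype m] [Fintype v] [Fintype w] [Fintype uv]
variable {Cu : Matrix w v ℂ} {Dg : Matrix v m ℂ} {Qs : Matrix u m ℂ} {Qv : Matrix uv v ℂ}

/-- **GAUGE POINCARÉ ⟹ COERCIVITY ON THE ORTHOGONAL SLICE** (abstract): if every field has a representative `A − Dμ`, `μ ∈ N(Q′)`, with
`‖A − Dμ‖² ≤ C₁‖CA‖² + C₂‖QA‖²`, then every field orthogonal to `D(N(Q′))` — the SHORTEST point of its residual orbit (Pythagoras) —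
obeys `c₀‖A‖² ≤ ‖CA‖² + a‖QA‖²` with `c₀ = (max C₁ (C₂/a))⁻¹`. [folklore] -/
theorem orthSlice_of_gaugePoincare {a C₁ C₂ : ℝ} (ha : 0 < a) (hC₁ : 0 ≤ C₁)
    (h : ∀ A : v → ℂ, ∃ mu : m → ℂ, Qs *ᵥ mu = 0 ∧ nsq (A - Dg *ᵥ mu) ≤ C₁ * nsq (Cu *ᵥ A) + C₂ * nsq (Qv *ᵥ A)) :
    OrthSliceCoercive Cu Dg Qs Qv a (max C₁ (C₂ / a))⁻¹ := by
  intro A hA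
  obtain ⟨mu, hmu, hb⟩ := h A
  set K := max C₁ (C₂ / a) with hK
  set X := nsq (Cu *ᵥ A); set Y := nsq (Qv *ᵥ A)
  have hX : 0 ≤ X := nsq_nonneg _; have hY : 0 ≤ Y := nsq_nonneg _
  have hK0 : 0 ≤ K := le_max_of_le_left hC₁
  have horth : star (Dg *ᵥ (-mu)) ⬝ᵥ A = 0 := hA (-mu) (by rw [Matrix.mulVec_neg, hmu, neg_zero])
  have hle : nsq A ≤ nsq (A - Dg *ᵥ mu) := by
    have e : A - Dg *ᵥ mu = A + Dg *ᵥ (-mu) := by rw [Matrix.mulVec_neg, sub_eq_add_neg]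
    rw [e, nsq_add_of_orth _ _ horth]
    have := nsq_nonneg (Dg *ᵥ (-mu))
    linarith
  have h2 : C₁ * X + C₂ * Y ≤ K * (X + a * Y) := by
    have e1 : C₁ * X ≤ K * X := mul_le_mul_of_nonneg_right (le_max_left _ _) hX
    have e2 : C₂ * Y ≤ K * (a * Y) := by
      have : C₂ = (C₂ / a) * a := by field_simp
      rw [this, mul_assoc]
      exact mul_le_mul_of_nonneg_right (le_max_right _ _) (by positivity)
    linarith
  have h3 : nsq A ≤ K * (X + a * Y) := hle.trans (hb.trans h2)
  by_cases hKp : 0 < K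
  · calc K⁻¹ * nsq A ≤ K⁻¹ * (K * (X + a * Y)) := mul_le_mul_of_nonneg_left h3 (inv_nonneg.mpr hK0)
      _ = X + a * Y := by field_simp
  · have hK' : K = 0 := le_antisymm (not_lt.mp hKp) hK0
    rw [hK', inv_zero, zero_mul]
    positivity

end Abstract

/-! ## §1 The graded vector averaging is bounded, level-free: `‖Q_GW X‖² ≤ (m+1)L^{2m}‖X‖²` -/

section GW

variable (L : ℕ) [NeZero L] (M : Fin d → ℕ) [hM : ∀ μ, NeZero (M μ)] (k m : ℕ) (layer : Tor M → ℕ) (a a' : ℝ)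

/-- the rows of ONE scale are bounded by the bond mass: `Σ_z |(Q_sX)(z,ν)|² ≤ s^{−d}·Σ_x |X(x,ν)|²` (Cauchy–Schwarz over the `s^{d+1}` bonds of
each contour family; every bond carries total weight `s·s^{−(d+1)}` across the families of its direction). [folklore] -/
theorem sum_norm_sq_avgS_le (s : ℕ) [NeZero s] (hs : ∀ ν, s ∣ fine (lev L k) M ν) (X : TorK L M k × Fin d → ℂ) (ν : Fin d) :
    ∑ z : Anc (fine (lev L k) M) s, ‖(avgS (fine (lev L k) M) s *ᵥ X) (z, ν)‖ ^ 2
      ≤ (((s : ℕ) : ℝ) ^ d)⁻¹ * ∑ x : TorK L M k, ‖X (x, ν)‖ ^ 2 := by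
  have hs0 : (0 : ℝ) < (s : ℝ) := by exact_mod_cast s_pos s
  have hcard : (Fintype.card ((Fin d → Fin s) × Fin s) : ℝ) = (s : ℝ) ^ (d + 1) := by
    rw [Fintype.card_prod, Fintype.card_fin, Nat.cast_mul, card_offsets, pow_succ]
  have row : ∀ z : Anc (fine (lev L k) M) s, ‖(avgS (fine (lev L k) M) s *ᵥ X) (z, ν)‖ ^ 2
      ≤ ((s : ℝ) ^ (d + 1))⁻¹ * ∑ j : Fin d → Fin s, ∑ t : Fin s, ‖X (site (fine (lev L k) M) s z.1 j + tstep (fine (lev L k) M) ν t, ν)‖ ^ 2 := by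
    intro z
    have e1 : (avgS (fine (lev L k) M) s *ᵥ X) (z, ν)
        = (((s : ℂ) ^ (d + 1)))⁻¹ * ∑ p : (Fin d → Fin s) × Fin s, X (site (fine (lev L k) M) s z.1 p.1 + tstep (fine (lev L k) M) ν p.2, ν) := by
      rw [avgS_mulVec (fine (lev L k) M) s hs X z ν, Fintype.sum_prod_type]
    have e2 : ∑ j : Fin d → Fin s, ∑ t : Fin s, ‖X (site (fine (lev L k) M) s z.1 j + tstep (fine (lev L k) M) ν t, ν)‖ ^ 2
        = ∑ p : (Fin d → Fin s) × Fin s, ‖X (site (fine (lev L k) M) s z.1 p.1 + tstep (fine (lev L k) M) ν p.2, ν)‖ ^ 2 := by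
      rw [Fintype.sum_prod_type]
    rw [e1, e2, norm_mul, mul_pow, norm_inv, norm_pow, Complex.norm_natCast]
    have hcs := norm_sq_sum_le (fun p : (Fin d → Fin s) × Fin s => X (site (fine (lev L k) M) s z.1 p.1 + tstep (fine (lev L k) M) ν p.2, ν))
    rw [hcard] at hcs
    calc (((s : ℝ) ^ (d + 1))⁻¹) ^ 2 * ‖∑ p : (Fin d → Fin s) × Fin s, X (site (fine (lev L k) M) s z.1 p.1 + tstep (fine (lev L k) M) ν p.2, ν)‖ ^ 2
        ≤ (((s : ℝ) ^ (d + 1))⁻¹) ^ 2 * ((s : ℝ) ^ (d + 1) * ∑ p : (Fin d → Fin s) × Fin s,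
            ‖X (site (fine (lev L k) M) s z.1 p.1 + tstep (fine (lev L k) M) ν p.2, ν)‖ ^ 2) :=
          mul_le_mul_of_nonneg_left hcs (sq_nonneg _)
      _ = ((s : ℝ) ^ (d + 1))⁻¹ * ∑ p : (Fin d → Fin s) × Fin s, ‖X (site (fine (lev L k) M) s z.1 p.1 + tstep (fine (lev L k) M) ν p.2, ν)‖ ^ 2 := by
          field_simp
  refine (Finset.sum_le_sum fun z _ => row z).trans ?_
  rw [← Finset.mul_sum]
  have tot : ∑ z : Anc (fine (lev L k) M) s, ∑ j : Fin d → Fin s, ∑ t : Fin s,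
      ‖X (site (fine (lev L k) M) s z.1 j + tstep (fine (lev L k) M) ν t, ν)‖ ^ 2 = (s : ℝ) * ∑ x : TorK L M k, ‖X (x, ν)‖ ^ 2 := by
    have e1 : ∀ t : Fin s, ∑ z : Anc (fine (lev L k) M) s, ∑ j : Fin d → Fin s,
        ‖X (site (fine (lev L k) M) s z.1 j + tstep (fine (lev L k) M) ν t, ν)‖ ^ 2 = ∑ x : TorK L M k, ‖X (x, ν)‖ ^ 2 := by
      intro t
      rw [← sum_sites_eq (fine (lev L k) M) s hs (fun x => ‖X (x + tstep (fine (lev L k) M) ν t, ν)‖ ^ 2)]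
      exact Fintype.sum_equiv (Equiv.addRight (tstep (fine (lev L k) M) ν t)) _ _ fun x => rfl
    calc _ = ∑ z : Anc (fine (lev L k) M) s, ∑ t : Fin s, ∑ j : Fin d → Fin s,
          ‖X (site (fine (lev L k) M) s z.1 j + tstep (fine (lev L k) M) ν t, ν)‖ ^ 2 :=
            Finset.sum_congr rfl fun z _ => Finset.sum_comm
      _ = ∑ t : Fin s, ∑ z : Anc (fine (lev L k) M) s, ∑ j : Fin d → Fin s,
          ‖X (site (fine (lev L k) M) s z.1 j + tstep (fine (lev L k) M) ν t, ν)‖ ^ 2 := Finset.sum_comm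
      _ = ∑ _t : Fin s, ∑ x : TorK L M k, ‖X (x, ν)‖ ^ 2 := Finset.sum_congr rfl fun t _ => e1 t
      _ = (s : ℝ) * ∑ x : TorK L M k, ‖X (x, ν)‖ ^ 2 := by rw [Finset.sum_const, Finset.card_univ, Fintype.card_fin, nsmul_eq_mul]
  rw [tot, ← mul_assoc, pow_succ, mul_inv, mul_assoc ((((s : ℕ) : ℝ) ^ d)⁻¹), inv_mul_cancel₀ hs0.ne', mul_one]

/-- **`‖Q_GW X‖² ≤ (m+1)·L^{2m}·‖X‖²`** — the graded vector averaging is bounded, LEVEL-FREE (`w_i²·s_i^{−d} = L^{2i} ≤ L^{2m}`). [folklore] -/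
theorem nsq_QvGW_mulVec_le (X : TorK L M k × Fin d → ℂ) :
    nsq (QvGW L M k m layer *ᵥ X) ≤ (m + 1) * (L : ℝ) ^ (2 * m) * nsq X := by
  have hL1 : (1 : ℝ) ≤ L := by exact_mod_cast Nat.pos_of_ne_zero (NeZero.ne L)
  rw [nsq_QvGW_eq_sum]
  have hX : nsq X = ∑ ν : Fin d, ∑ x : TorK L M k, ‖X (x, ν)‖ ^ 2 := by
    unfold nsq; rw [Fintype.sum_prod_type_right]
  have lay : ∀ i : Fin (m + 1), ∑ zν : Anc (fine (lev L k) M) (sGW L k i) × Fin d,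
      (if rowMin L M k m layer i zν.1 zν.2 = (i : ℕ) then wGW L k d i ^ 2 * ‖(avgS (fine (lev L k) M) (sGW L k i) *ᵥ X) zν‖ ^ 2 else 0)
      ≤ (L : ℝ) ^ (2 * m) * nsq X := by
    intro i
    calc _ ≤ ∑ zν : Anc (fine (lev L k) M) (sGW L k i) × Fin d, wGW L k d i ^ 2 * ‖(avgS (fine (lev L k) M) (sGW L k i) *ᵥ X) zν‖ ^ 2 :=
          Finset.sum_le_sum fun zν _ => by split_ifs <;> first | exact le_rfl | positivity
      _ = wGW L k d i ^ 2 * ∑ ν : Fin d, ∑ z : Anc (fine (lev L k) M) (sGW L k i), ‖(avgS (fine (lev L k) M) (sGW L k i) *ᵥ X) (z, ν)‖ ^ 2 := by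
          rw [Finset.mul_sum, Fintype.sum_prod_type_right]
          refine Finset.sum_congr rfl fun ν _ => by rw [Finset.mul_sum]
      _ ≤ wGW L k d i ^ 2 * ∑ ν : Fin d, ((((sGW L k i : ℕ) : ℝ) ^ d)⁻¹ * ∑ x : TorK L M k, ‖X (x, ν)‖ ^ 2) :=
          mul_le_mul_of_nonneg_left (Finset.sum_le_sum fun ν _ => sum_norm_sq_avgS_le L M k (sGW L k i) (sGW_dvd L M k i) X ν) (sq_nonneg _)
      _ = (L : ℝ) ^ (2 * (i : ℕ)) * nsq X := by
          rw [← Finset.mul_sum, ← mul_assoc, hX, wGW_sq]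
          have hs : (((sGW L k i : ℕ) : ℝ) ^ d) ≠ 0 := pow_ne_zero _ (by exact_mod_cast NeZero.ne (sGW L k i))
          field_simp
      _ ≤ (L : ℝ) ^ (2 * m) * nsq X :=
          mul_le_mul_of_nonneg_right (pow_le_pow_right₀ hL1 (by have := i.isLt; omega)) (nsq_nonneg _)
  calc _ ≤ ∑ _i : Fin (m + 1), (L : ℝ) ^ (2 * m) * nsq X := Finset.sum_le_sum fun i _ => lay i
    _ = (m + 1) * (L : ℝ) ^ (2 * m) * nsq X := by
        rw [Finset.sum_const, Finset.card_univ, Fintype.card_fin, nsmul_eq_mul]; push_cast; ring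

/-! ## §2 The three scalar hypotheses of gen 8's reduction, for the graded well -/

/-- `Q′_GWn μ = 0 → Q′_GWw μ = 0` (same kernel, different row weights). [folklore] -/
theorem QsGWw_eq_zero_of_QsGWn {mu : TorK L M k → ℂ} (h : QsGWn L M k m layer *ᵥ mu = 0) : QsGWw L M k m layer *ᵥ mu = 0 := by
  have h1 := QsGW_mulVec_eq_zero_of_normalised L M k m layer h
  funext p
  have hp : (QsGW L M k m layer *ᵥ mu) p = 0 := congrFun h1 p
  have e : (QsGW L M k m layer *ᵥ mu) p = (meanS (fine (lev L k) M) (sGW L k p.1.1) *ᵥ mu) p.1.2 := by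
    simp only [Matrix.mulVec, dotProduct, QsGW]
  rw [QsGWw_mulVec_apply, ← e, hp, mul_zero, Pi.zero_apply]

/-- **hP — THE GRADED BLOCK POINCARÉ INEQUALITY ON `N(Q′_GW)`**: `Q′_GWn μ = 0 → ‖μ‖² ≤ 8d(m+1)·‖∂μ‖²` (owner's `nsq_le_graded`). [folklore] -/
theorem hP_GW (hlay : ∀ y, layer y ≤ m) (mu : TorK L M k → ℂ) (h : QsGWn L M k m layer *ᵥ mu = 0) :
    nsq mu ≤ (8 * d * (m + 1)) * nsq (gradT L M k *ᵥ mu) := by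
  have h1 := nsq_le_graded L M k m layer hlay mu
  rw [QsGWw_eq_zero_of_QsGWn L M k m layer h] at h1
  rw [nsq_GradOp_mulVec, dirichlet]
  have h0 : nsq (0 : RowS L M k m layer → ℂ) = 0 := by simp [nsq]
  rw [h0, mul_zero, add_zero] at h1
  exact h1

/-- **hκ — THE LEVEL-FREE VARIATIONAL BOUND ON GRADED BLOCK CONSTANTS**: `σ_GW·‖Q′_GWnᴴφ‖² ≤ re⟨Q′_GWnᴴφ, G′_GW Q′_GWnᴴφ⟩`
(leaf-05-g10's `GradedWellGram.form_SGW_ge`, re-read with `Q′_GWn Q′_GWnᴴ = 1`). [folklore] -/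
theorem hκ_GW (hlay : ∀ y, layer y ≤ m) (ha' : 0 < a') (φ : RowS L M k m layer → ℂ) :
    sigGW d L m a' * nsq ((QsGWn L M k m layer)ᴴ *ᵥ φ)
      ≤ (star ((QsGWn L M k m layer)ᴴ *ᵥ φ) ⬝ᵥ (GOmGW L M k m layer a' *ᵥ ((QsGWn L M k m layer)ᴴ *ᵥ φ))).re := by
  have hQQ : QsGWn L M k m layer * (QsGWn L M k m layer)ᴴ = ((1 : ℝ) : ℂ) • (1 : Matrix (RowS L M k m layer) (RowS L M k m layer) ℂ) := by
    rw [QsGWn_mul_conjTranspose, Complex.ofReal_one, one_smul]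
  rw [nsq_QH_mulVec _ hQQ, one_mul, ← dotProduct_mulVec_eq_star_conjTranspose_mulVec]
  exact form_SGW_ge L M k m layer a' (isUnit_det_DpGW L M k m layer a' hlay ha') ha' φ

/-- **hL — `∂ᴴ∂ ≤ Δ′_GW` as forms**: `‖∂φ‖² ≤ re⟨φ, Δ′_GWφ⟩` (`a′ ≥ 0`). [folklore] -/
theorem hL_GW (ha' : 0 ≤ a') (φ : TorK L M k → ℂ) :
    nsq (gradT L M k *ᵥ φ) ≤ (star φ ⬝ᵥ (DpGW L M k m layer a' *ᵥ φ)).re := by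
  rw [form_DpGW, nsq_GradOp_mulVec, dirichlet]
  have := mul_nonneg ha' (nsq_nonneg (QsGWw L M k m layer *ᵥ φ))
  linarith

/-! ## §3 The graded gauge Poincaré inequality, modulo «GW-V» -/

/-- the first constant: `C₁ = (2 + 4·C_E·(m+1)L^{2m})/γ_D`. [folklore] -/
def C1GW (d L m : ℕ) (a : ℝ) : ℝ := (2 + 4 * CE d m * ((m + 1) * (L : ℝ) ^ (2 * m))) / gamD d a

/-- the second constant: `C₂ = a·C₁ + 4·C_E`. [folklore] -/
def C2GW (d L m : ℕ) (a : ℝ) : ℝ := a * C1GW d L m a + 4 * CE d m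

omit hM in
/-- `0 ≤ C_E`. [folklore] -/
theorem CE_nonneg : 0 ≤ CE d m := by unfold CE; positivity

omit [NeZero L] hM in
/-- `0 < C₁`. [folklore] -/
theorem C1GW_pos : 0 < C1GW d L m a := by
  unfold C1GW
  have := CE_nonneg (d := d) (m := m)
  have := gamD_pos (d := d) a
  positivity

omit [NeZero L] hM in
/-- `0 ≤ C₂` (`a ≥ 0`). [folklore] -/
theorem C2GW_nonneg (ha : 0 ≤ a) : 0 ≤ C2GW d L m a := by
  unfold C2GW
  have := (C1GW_pos (d := d) L (m := m) a).le
  have := CE_nonneg (d := d) (m := m)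
  positivity

/-- **THE GRADED GAUGE POINCARÉ INEQUALITY, modulo «GW-V»**: if the graded vector mass dominates the unit mass (`hV`), then every vector field
`A` on the level torus admits `μ ∈ N(Q′_GWn)` (ALL graded means zero) with `‖A − ∂μ‖² ≤ C₁‖curl A‖² + C₂‖Q_GW A‖²`, `C₁, C₂` LEVEL-FREE.
[cite: Balaban1984PropagatorsI, Prop. 1.1 (1.90) p.33 (kernel version, orbit form transferred to graded data; constants ours)] [folklore] -/
theorem gaugePoincare_GW_of_unitMass (ha : 0 < a) (ha' : 0 < a')
    (hV : ∀ A : TorK L M k × Fin d → ℂ, ((lev L k : ℕ) : ℝ) ^ d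
        * ∑ z : Anc (fine (lev L k) M) (lev L k), ∑ μ : Fin d, ‖(avgS (fine (lev L k) M) (lev L k) *ᵥ A) (z, μ)‖ ^ 2
        ≤ nsq (QvGW L M k m layer *ᵥ A))
    (A : TorK L M k × Fin d → ℂ) :
    ∃ mu : TorK L M k → ℂ, QsGWn L M k m layer *ᵥ mu = 0 ∧
      nsq (A - gradT L M k *ᵥ mu) ≤ C1GW d L m a * nsq (curlT L M k *ᵥ A) + C2GW d L m a * nsq (QvGW L M k m layer *ᵥ A) := by
  obtain ⟨mu0, hmu0, hb0⟩ := exists_unit_gauge L M k a a' ha ha' A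
  obtain ⟨ρ, hρ, hρE⟩ := exists_meanCorrection L M k m layer mu0 (meanS_eq_zero_of_QsOp (lev L k) M mu0 hmu0)
  refine ⟨mu0 - ρ, ?_, ?_⟩
  · rw [Matrix.mulVec_sub, hρ, sub_self]
  set P := nsq (A - gradT L M k *ᵥ mu0) with hP
  set X := nsq (curlT L M k *ᵥ A) with hXd
  set Y := nsq (QvGW L M k m layer *ᵥ A) with hYd
  set CQ : ℝ := (m + 1) * (L : ℝ) ^ (2 * m) with hCQ
  have hγ := gamD_pos (d := d) a
  have hP0 : 0 ≤ P := nsq_nonneg _; have hX0 : 0 ≤ X := nsq_nonneg _; have hY0 : 0 ≤ Y := nsq_nonneg _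
  have hCE := CE_nonneg (d := d) (m := m)
  have hCQ0 : 0 ≤ CQ := by positivity
  have hV' : a * ((lev L k : ℕ) : ℝ) ^ d * nsq (QvOp (lev L k) M *ᵥ A) ≤ a * Y := by
    rw [nsq_QvOp_eq_sum_avgS, mul_assoc]
    exact mul_le_mul_of_nonneg_left (hV A) ha.le
  have h1 : P ≤ (gamD d a)⁻¹ * (X + a * Y) := by
    rw [le_inv_mul_iff₀ hγ]
    linarith
  have h2 : nsq (QvGW L M k m layer *ᵥ (gradT L M k *ᵥ mu0)) ≤ 2 * Y + 2 * (CQ * P) := by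
    have e : gradT L M k *ᵥ mu0 = A - (A - gradT L M k *ᵥ mu0) := by abel
    rw [e, Matrix.mulVec_sub]
    have e2 : QvGW L M k m layer *ᵥ A - QvGW L M k m layer *ᵥ (A - gradT L M k *ᵥ mu0)
        = QvGW L M k m layer *ᵥ A + (-(QvGW L M k m layer *ᵥ (A - gradT L M k *ᵥ mu0))) := sub_eq_add_neg _ _
    rw [e2]
    refine (nsq_add_le _ _).trans ?_
    have e3 : nsq (-(QvGW L M k m layer *ᵥ (A - gradT L M k *ᵥ mu0))) = nsq (QvGW L M k m layer *ᵥ (A - gradT L M k *ᵥ mu0)) := by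
      simp [nsq]
    rw [e3]
    have := nsq_QvGW_mulVec_le L M k m layer (A - gradT L M k *ᵥ mu0)
    linarith
  have h3 : nsq (A - gradT L M k *ᵥ (mu0 - ρ)) ≤ 2 * P + 2 * nsq (gradT L M k *ᵥ ρ) := by
    have e : A - gradT L M k *ᵥ (mu0 - ρ) = (A - gradT L M k *ᵥ mu0) + gradT L M k *ᵥ ρ := by
      rw [Matrix.mulVec_sub]; abel
    rw [e]
    exact nsq_add_le _ _
  have h4 : nsq (gradT L M k *ᵥ ρ) ≤ CE d m * (2 * Y + 2 * (CQ * P)) := hρE.trans (mul_le_mul_of_nonneg_left h2 hCE)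
  have h5 : nsq (A - gradT L M k *ᵥ (mu0 - ρ)) ≤ (2 + 4 * CE d m * CQ) * P + 4 * CE d m * Y := by nlinarith
  have h6 : (2 + 4 * CE d m * CQ) * P ≤ (2 + 4 * CE d m * CQ) * ((gamD d a)⁻¹ * (X + a * Y)) :=
    mul_le_mul_of_nonneg_left h1 (by positivity)
  have eC1 : C1GW d L m a = (2 + 4 * CE d m * CQ) * (gamD d a)⁻¹ := by rw [C1GW, hCQ, div_eq_mul_inv]
  have eC2 : C2GW d L m a = a * C1GW d L m a + 4 * CE d m := rfl
  rw [eC2, eC1]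
  nlinarith

/-! ## §4 Slice coercivity of the graded well, modulo «GW-V» -/

/-- the constant of the orthogonal slice: `c₀ = (max C₁ (C₂/a))⁻¹`. [folklore] -/
def c0GW (d L m : ℕ) (a : ℝ) : ℝ := (max (C1GW d L m a) (C2GW d L m a / a))⁻¹

omit [NeZero L] hM in
/-- `0 < c₀`. [folklore] -/
theorem c0GW_pos : 0 < c0GW d L m a :=
  inv_pos.mpr (lt_max_of_lt_left (C1GW_pos (d := d) L (m := m) a))

/-- **COERCIVITY ON THE ORTHOGONAL SLICE OF THE GRADED WELL, modulo «GW-V»**. [folklore] -/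
theorem orthSlice_GW_of_unitMass (ha : 0 < a) (ha' : 0 < a')
    (hV : ∀ A : TorK L M k × Fin d → ℂ, ((lev L k : ℕ) : ℝ) ^ d
        * ∑ z : Anc (fine (lev L k) M) (lev L k), ∑ μ : Fin d, ‖(avgS (fine (lev L k) M) (lev L k) *ᵥ A) (z, μ)‖ ^ 2
        ≤ nsq (QvGW L M k m layer *ᵥ A)) :
    OrthSliceCoercive (curlT L M k) (gradT L M k) (QsGWn L M k m layer) (QvGW L M k m layer) a (c0GW d L m a) :=
  orthSlice_of_gaugePoincare ha (C1GW_pos (d := d) L (m := m) a).le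
    (gaugePoincare_GW_of_unitMass L M k m layer a a' ha ha' hV)

/-- **THE (GW-W1) CONSTANT**: `cGW = c₀/(1 + 8d(m+1)/σ_GW)` — depends on `d, L, m, a, a′` only. [folklore] -/
def cGW (d L m : ℕ) (a a' : ℝ) : ℝ := c0GW d L m a / (1 + (8 * d * (m + 1)) / sigGW d L m a')

/-- `0 < cGW`. [folklore] -/
theorem cGW_pos (ha' : 0 < a') : 0 < cGW d L m a a' := by
  unfold cGW
  have := c0GW_pos (d := d) L (m := m) a
  have := sigGW_pos (d := d) (L := L) (m := m) a' ha'
  positivity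

/-- **SLICE COERCIVITY OF THE GRADED WELL, LEVEL-FREE, modulo «GW-V»**: if the graded vector mass dominates the unit mass (`hV`, leaf-07-g11's
`GradedWellUnitMass.unitMass_le_nsq_QvGW`), then for every `A′` on Bałaban's slice `R_GW·∂ᴴA′ = 0` of the graded well,
`cGW·‖A′‖² ≤ ‖curl A′‖² + a‖Q_GW A′‖²` with `cGW = cGW(d, L, m, a, a′) > 0` independent of the level `k` and of the layer map.
[cite: Balaban1985BackgroundPropagators, (3.26)–(3.27) p.395 (shape: positivity of Δ_a, existence of G)] [folklore] -/
theorem sliceCoercive_GW_of_unitMass (hlay : ∀ y, layer y ≤ m) (ha : 0 < a) (ha' : 0 < a')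
    (hV : ∀ A : TorK L M k × Fin d → ℂ, ((lev L k : ℕ) : ℝ) ^ d
        * ∑ z : Anc (fine (lev L k) M) (lev L k), ∑ μ : Fin d, ‖(avgS (fine (lev L k) M) (lev L k) *ᵥ A) (z, μ)‖ ^ 2
        ≤ nsq (QvGW L M k m layer *ᵥ A)) :
    SliceCoercive (curlT L M k) (gradT L M k) (GOmGW L M k m layer a') (QsGWn L M k m layer) (QvGW L M k m layer) a (cGW d L m a a') := by
  have hD := isUnit_det_DpGW L M k m layer a' hlay ha'
  have hD0 := opNorm_DpGW_pos L M k m layer a' hlay ha'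
  have hQQ : QsGWn L M k m layer * (QsGWn L M k m layer)ᴴ = ((1 : ℝ) : ℂ) • (1 : Matrix (RowS L M k m layer) (RowS L M k m layer) ℂ) := by
    rw [QsGWn_mul_conjTranspose, Complex.ofReal_one, one_smul]
  have h := sliceCoercive_of_orthSlice (a := a) (sliceData_GW L M k m layer a' hlay hD hD0) hQQ one_pos (by positivity : (0 : ℝ) ≤ 8 * d * (m + 1))
    (sigGW_pos (d := d) (L := L) (m := m) a' ha') (c0GW_pos (d := d) L (m := m) a).le (hP_GW L M k m layer hlay)
    (hκ_GW L M k m layer a' hlay ha') (hL_GW L M k m layer a' ha'.le) (orthSlice_GW_of_unitMass L M k m layer a a' ha ha' hV)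
  exact h

/-! ## §5 THE ENDs: (GW-W1) and «`G_GW` exists with a level-free bound» -/

/-- **THE GRADED GAUGE POINCARÉ INEQUALITY** (`2 ≤ L`): every vector field `A` on the level torus admits `μ ∈ N(Q′_GWn)` with
`‖A − ∂μ‖² ≤ C₁‖curl A‖² + C₂‖Q_GW A‖²`, `C₁, C₂` depending on `d, L, m, a` only («GW-V» by leaf-07-g11 BY NAME).
[cite: Balaban1984PropagatorsI, Prop. 1.1 (1.90) p.33 (kernel version, orbit form transferred to graded data; constants ours)] [folklore] -/
theorem gaugePoincare_GW (hL : 2 ≤ L) (hlay : ∀ y, layer y ≤ m) (ha : 0 < a) (ha' : 0 < a') (A : TorK L M k × Fin d → ℂ) :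
    ∃ mu : TorK L M k → ℂ, QsGWn L M k m layer *ᵥ mu = 0 ∧
      nsq (A - gradT L M k *ᵥ mu) ≤ C1GW d L m a * nsq (curlT L M k *ᵥ A) + C2GW d L m a * nsq (QvGW L M k m layer *ᵥ A) :=
  gaugePoincare_GW_of_unitMass L M k m layer a a' ha ha' (unitMass_le_nsq_QvGW L M k m layer hL hlay) A

/-- **(GW-W1) — SLICE COERCIVITY OF THE GRADED WELL, LEVEL-FREE**: for `2 ≤ L`, `layer ≤ m`, `0 < a`, `0 < a′`, every `A′` on Bałaban's slice
`R_GW·∂ᴴA′ = 0` of the graded well obeys `cGW·‖A′‖² ≤ ‖curl A′‖² + a‖Q_GW A′‖²`, `cGW = cGW(d, L, m, a, a′) > 0` INDEPENDENT of the level `k` and of the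
layer map — the row-NE2 owner's socket (GW-W1) of R47 (e)/R48 (c)/R49 (a).
[cite: Balaban1985BackgroundPropagators, (3.26)–(3.27) p.395 (shape: positivity of Δ_a, existence of G)] [folklore] -/
theorem sliceCoercive_GW (hL : 2 ≤ L) (hlay : ∀ y, layer y ≤ m) (ha : 0 < a) (ha' : 0 < a') :
    SliceCoercive (curlT L M k) (gradT L M k) (GOmGW L M k m layer a') (QsGWn L M k m layer) (QvGW L M k m layer) a (cGW d L m a a') :=
  sliceCoercive_GW_of_unitMass L M k m layer a a' hlay ha ha' (unitMass_le_nsq_QvGW L M k m layer hL hlay)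

/-- **THE FAITHFUL GRADED-WELL OPERATOR IS COERCIVE, LEVEL-FREE**: `regionGW ≥ min(cGW/2, 1/(2γ_GW⁻¹))` (owner's `coercive_regionGW_of_slice`
with (GW-W1) and (GW-S0) `‖G′_GW‖ ≤ γ_GW⁻¹` supplied). [cite: Balaban1985BackgroundPropagators, (3.27) p.395 (shape: existence of G)] [folklore] -/
theorem coercive_regionGW (hL : 2 ≤ L) (hlay : ∀ y, layer y ≤ m) (ha : 0 < a) (ha' : 0 < a') :
    Coercive (regionGW L M k m layer a a') (min (cGW d L m a a' / 2) (1 / (2 * (gamGW d m a')⁻¹))) :=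
  coercive_regionGW_of_slice L M k m layer a a' hlay (isUnit_det_DpGW L M k m layer a' hlay ha') (opNorm_DpGW_pos L M k m layer a' hlay ha')
    (cGW_pos (d := d) L (m := m) a a' ha') (sliceCoercive_GW L M k m layer a a' hL hlay ha ha') (opNorm_GOmGW_le L M k m layer a' hlay ha')
    (inv_pos.mpr (gamGW_pos (d := d) (m := m) a' ha'))

/-- **… WITH `‖G_GW‖ ≤ max(2/cGW, 2γ_GW⁻¹)` UNIFORMLY IN THE LEVEL** — the `γ` of R49 (a) «(GW-W1) + (GW-S0) ⟹ γ», in the kernel.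
[cite: Balaban1985BackgroundPropagators, (3.27) p.395 (shape)] [folklore] -/
theorem opNorm_inv_regionGW_le (hL : 2 ≤ L) (hlay : ∀ y, layer y ≤ m) (ha : 0 < a) (ha' : 0 < a') :
    ‖(regionGW L M k m layer a a')⁻¹‖ ≤ (min (cGW d L m a a' / 2) (1 / (2 * (gamGW d m a')⁻¹)))⁻¹ :=
  opNorm_inv_regionGW_le_of_slice L M k m layer a a' hlay (isUnit_det_DpGW L M k m layer a' hlay ha') (opNorm_DpGW_pos L M k m layer a' hlay ha')
    (cGW_pos (d := d) L (m := m) a a' ha') (sliceCoercive_GW L M k m layer a a' hL hlay ha ha') (opNorm_GOmGW_le L M k m layer a' hlay ha')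
    (inv_pos.mpr (gamGW_pos (d := d) (m := m) a' ha'))

end GW

end Summit.QuantumFields.BalabanUV.T4Continuum.GradedWellSliceCoercive

end
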